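import Mathlib
import Literature.NumberTheory.Transcendental.KZProductIdeal
import Literature.NumberTheory.Transcendental.KZCalculusOver
import HarnessLib

/-!
# The Fubini product of the calculus `KZ_k` with coefficients in a ring `k`

File of the solo-informed residency (s235).  The tree's calculus with coefficients
(`KZOver.IntegralRep k`, `KZOver.FormalRep k`, `KZOver.relations k` of `KZCalculusOver.lean`:
the four Kontsevich–Zagier moves with `k`-semialgebraic data, `k → ℝ` any coefficient ring;
`k = ℚ` is KZ's calculus, `k = ℝ` the real-semialgebraic calculus of Cresson–Viu-Sos) has so far
no product: `KZProduct.lean` / `KZProductIdeal.lean` treat `k = ℚ` only, and the residency's file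
`SoloInformedRealDiscTransfer` supplies over `ℝ` only the disc cylinder `D̄ × [τ, g]`.  This file
ports the Fubini product to every coefficient ring `k`, with no classical `if`: the
Tarski–Seidenberg theorem is proved in the tree for every `k`
(`Literature.ModelTheory.ExponentialFields.tarski_seidenberg_real_holds`), so `f ⊗ g` is a
`k`-semialgebraic function on `σ × τ` outright (`IsSemialgebraicFunOn.mul_holds`).

* `soloInformedProdOver r s : KZOver.IntegralRep k (n + m)` — `[σ, f] · [τ, g] = [σ × τ, f ⊗ g]`;
  `soloInformed_value_prodOver` — `value (σ × τ, f ⊗ g) = value [σ, f] · value [τ, g]` (Fubini).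
* the cylinder lemmas over `k` (`soloInformed_isSemialgebraic_cylOver`,
  `soloInformed_isSemialgebraicFunOn_cylOver_left/right`), used again by the ideal property
  (file `SoloInformedProductIdealOver`).
* `soloInformedSigmaMulOver : Mul (Σ n, KZOver.IntegralRep k n)` — through Mathlib's
  `FreeAbelianGroup.nonUnitalNonAssocRing` this equips `KZOver.FormalRep k` with the biadditive
  product extending `soloInformedProdOver`; `soloInformed_ofOver_mul_ofOver`;
  **`soloInformed_evalOver_mul`** — `eval (c * c') = eval c * eval c'`.
* `soloInformed_prodOver_baseChange`, **`soloInformed_baseChangeOver_mul`** — base change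
  `KZ_k → KZ_{k'}` is multiplicative; `soloInformed_prodOver_ofKZ`, `soloInformed_equivKZ_mul` —
  on `ℚ`-data the product IS the product of `KZProduct.lean` (transported along `KZOver.equivKZ`).

Bearing (residency verdict, `paper/real-parameters.md` (S1)): the statement "`P_ℝ` is a
commutative `ℝ`-algebra and `ev` an algebra homomorphism" was so far on paper; this is its
first kernel piece (the product and Fubini).  Nothing here bears on Conjecture 1 itself.

References: M. Kontsevich, D. Zagier, *Periods* (2001), §1.1, §1.2, §4.1 (p. 31: "the product of
integrals is again an integral (Fubini formula)"); J. Bochnak, M. Coste, M.-F. Roy, *Real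
Algebraic Geometry* (1998), §2.1, Prop. 2.2.6; J. Cresson, J. Viu-Sos, JTNB 34 (2022), §1.
-/

noncomputable section

open Set MeasureTheory
open Literature.ModelTheory.ExponentialFields Literature.NumberTheory.Transcendental

namespace Summit.KontsevichZagierPeriods.KontsevichZagierPeriods.Theorems

variable {k : Type*} [CommRing k] [Algebra k ℝ] {n m l d : ℕ}

/-! ### Cylinders over `k` -/

/-- The cylinder `A × B ⊆ ℝˡ⁺ᵈ` over two `k`-semialgebraic sets is `k`-semialgebraic (two
coordinate preimages; no Tarski–Seidenberg). -/
theorem soloInformed_isSemialgebraic_cylOver {A : Set (Fin l → ℝ)} {B : Set (Fin d → ℝ)}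
    (hA : IsSemialgebraic k A) (hB : IsSemialgebraic k B) :
    IsSemialgebraic k {z : Fin (l + d) → ℝ | (fun i => z (Fin.castAdd d i)) ∈ A ∧
      (fun j => z (Fin.natAdd l j)) ∈ B} :=
  (hA.preimage_comp (Fin.castAdd d)).inter (hB.preimage_comp (Fin.natAdd l))

/-- A `k`-semialgebraic function of the trailing block, `z ↦ F (z|ᵈ)`, is `k`-semialgebraic on the
cylinder `A × B` (a coordinate preimage of the graph of `F`; no Tarski–Seidenberg). -/
theorem soloInformed_isSemialgebraicFunOn_cylOver_right {A : Set (Fin l → ℝ)} {B : Set (Fin d → ℝ)}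
    {F : (Fin d → ℝ) → ℝ} (hA : IsSemialgebraic k A) (hB : IsSemialgebraic k B)
    (hF : IsSemialgebraicFunOn k B F) :
    IsSemialgebraicFunOn k {z : Fin (l + d) → ℝ | (fun i => z (Fin.castAdd d i)) ∈ A ∧
      (fun j => z (Fin.natAdd l j)) ∈ B} (fun z => F fun j => z (Fin.natAdd l j)) := by
  rw [isSemialgebraicFunOn_iff]
  let ρ : Fin (d + 1) → Fin (l + d + 1) :=
    Fin.lastCases (Fin.last (l + d)) fun j => Fin.castSucc (Fin.natAdd l j)
  have hΓ := (isSemialgebraicFunOn_iff.mp hF).preimage_comp ρ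
  convert (soloInformed_isSemialgebraic_cylOver hA hB).setOf_init_mem.inter hΓ using 1
  have hinit : ∀ w : Fin (l + d + 1) → ℝ,
      Fin.init (w ∘ ρ) = fun j => Fin.init w (Fin.natAdd l j) := by
    intro w; ext j; simp [Fin.init, ρ]
  have hlast : ∀ w : Fin (l + d + 1) → ℝ, (w ∘ ρ) (Fin.last d) = w (Fin.last (l + d)) := by
    intro w; simp [ρ]
  ext w
  simp only [mem_setOf_eq, mem_inter_iff, mem_preimage, hinit, hlast]
  tauto

/-- A `k`-semialgebraic function of the leading block, `z ↦ G (z|ₗ)`, is `k`-semialgebraic on the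
cylinder `A × B` (no Tarski–Seidenberg). -/
theorem soloInformed_isSemialgebraicFunOn_cylOver_left {A : Set (Fin l → ℝ)} {B : Set (Fin d → ℝ)}
    {G : (Fin l → ℝ) → ℝ} (hA : IsSemialgebraic k A) (hB : IsSemialgebraic k B)
    (hG : IsSemialgebraicFunOn k A G) :
    IsSemialgebraicFunOn k {z : Fin (l + d) → ℝ | (fun i => z (Fin.castAdd d i)) ∈ A ∧
      (fun j => z (Fin.natAdd l j)) ∈ B} (fun z => G fun i => z (Fin.castAdd d i)) := by
  rw [isSemialgebraicFunOn_iff]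
  let ρ : Fin (l + 1) → Fin (l + d + 1) :=
    Fin.lastCases (Fin.last (l + d)) fun i => Fin.castSucc (Fin.castAdd d i)
  have hΓ := (isSemialgebraicFunOn_iff.mp hG).preimage_comp ρ
  convert (soloInformed_isSemialgebraic_cylOver hA hB).setOf_init_mem.inter hΓ using 1
  have hinit : ∀ w : Fin (l + d + 1) → ℝ,
      Fin.init (w ∘ ρ) = fun i => Fin.init w (Fin.castAdd d i) := by
    intro w; ext i; simp [Fin.init, ρ]
  have hlast : ∀ w : Fin (l + d + 1) → ℝ, (w ∘ ρ) (Fin.last l) = w (Fin.last (l + d)) := by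
    intro w; simp [ρ]
  ext w
  simp only [mem_setOf_eq, mem_inter_iff, mem_preimage, hinit, hlast]
  tauto

/-- **Products resolve over every `k`** (Tarski–Seidenberg, proved in the tree): `z ↦ G (z|ₗ) · F (z|ᵈ)`
is `k`-semialgebraic on the cylinder `A × B`. -/
theorem soloInformed_isSemialgebraicFunOn_cylOver_mul {A : Set (Fin l → ℝ)} {B : Set (Fin d → ℝ)}
    {G : (Fin l → ℝ) → ℝ} {F : (Fin d → ℝ) → ℝ} (hA : IsSemialgebraic k A) (hB : IsSemialgebraic k B)
    (hG : IsSemialgebraicFunOn k A G) (hF : IsSemialgebraicFunOn k B F) :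
    IsSemialgebraicFunOn k {z : Fin (l + d) → ℝ | (fun i => z (Fin.castAdd d i)) ∈ A ∧
      (fun j => z (Fin.natAdd l j)) ∈ B}
      (fun z => G (fun i => z (Fin.castAdd d i)) * F (fun j => z (Fin.natAdd l j))) :=
  IsSemialgebraicFunOn.mul_holds (soloInformed_isSemialgebraicFunOn_cylOver_left hA hB hG)
    (soloInformed_isSemialgebraicFunOn_cylOver_right hA hB hF)

/-! ### The product of two integral representations over `k` -/

/-- The product domain `σ × τ ⊆ ℝⁿ⁺ᵐ`: first `n` coordinates in `σ`, last `m` in `τ`. -/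
def soloInformedProdDomainOver (r : KZOver.IntegralRep k n) (s : KZOver.IntegralRep k m) :
    Set (Fin (n + m) → ℝ) :=
  {z | (fun i => z (Fin.castAdd m i)) ∈ r.domain ∧ (fun j => z (Fin.natAdd n j)) ∈ s.domain}

/-- The product function `(f ⊗ g) z = f (z|ₙ) · g (z|ᵐ)`. -/
def soloInformedProdFunOver (r : KZOver.IntegralRep k n) (s : KZOver.IntegralRep k m) :
    (Fin (n + m) → ℝ) → ℝ :=
  fun z => r.integrand (fun i => z (Fin.castAdd m i)) * s.integrand (fun j => z (Fin.natAdd n j))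

section Prod

variable (r : KZOver.IntegralRep k n) (s : KZOver.IntegralRep k m)

/-- Membership in the product domain. -/
@[simp] theorem soloInformed_mem_prodDomainOver (z : Fin (n + m) → ℝ) :
    z ∈ soloInformedProdDomainOver r s ↔
      (fun i => z (Fin.castAdd m i)) ∈ r.domain ∧ (fun j => z (Fin.natAdd n j)) ∈ s.domain :=
  Iff.rfl

/-- Unfolding the product function. -/
theorem soloInformed_prodFunOver_apply (z : Fin (n + m) → ℝ) :
    soloInformedProdFunOver r s z =
      r.integrand (fun i => z (Fin.castAdd m i)) * s.integrand (fun j => z (Fin.natAdd n j)) :=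
  rfl

/-- `Fin.append x y ∈ σ × τ ↔ x ∈ σ ∧ y ∈ τ`. -/
@[simp] theorem soloInformed_append_mem_prodDomainOver (x : Fin n → ℝ) (y : Fin m → ℝ) :
    Fin.append x y ∈ soloInformedProdDomainOver r s ↔ x ∈ r.domain ∧ y ∈ s.domain := by
  simp [soloInformedProdDomainOver]

/-- `(f ⊗ g) (x, y) = f x · g y`. -/
@[simp] theorem soloInformed_prodFunOver_append (x : Fin n → ℝ) (y : Fin m → ℝ) :
    soloInformedProdFunOver r s (Fin.append x y) = r.integrand x * s.integrand y := by
  simp [soloInformedProdFunOver]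

/-- Under `Fin.append`, the product domain is the set-theoretic product `σ ×ˢ τ`. -/
theorem soloInformed_preimage_prodDomainOver :
    KZ.appendMeasurableEquiv n m ⁻¹' soloInformedProdDomainOver r s = r.domain ×ˢ s.domain := by
  ext p
  simp

/-- The product domain is `k`-semialgebraic. -/
theorem soloInformed_isSemialgebraic_prodDomainOver :
    IsSemialgebraic k (soloInformedProdDomainOver r s) :=
  soloInformed_isSemialgebraic_cylOver r.isSemialgebraic_domain s.isSemialgebraic_domain

/-- `f ⊗ g` is a `k`-semialgebraic function on `σ × τ` (Tarski–Seidenberg, BCR Prop. 2.2.6). -/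
theorem soloInformed_isSemialgebraicFunOn_prodFunOver :
    IsSemialgebraicFunOn k (soloInformedProdDomainOver r s) (soloInformedProdFunOver r s) :=
  soloInformed_isSemialgebraicFunOn_cylOver_mul r.isSemialgebraic_domain s.isSemialgebraic_domain
    r.isSemialgebraicFunOn_integrand s.isSemialgebraicFunOn_integrand

/-- **Tonelli.** `f ⊗ g` is absolutely integrable on `σ × τ`. -/
theorem soloInformed_integrableOn_prodFunOver :
    IntegrableOn (soloInformedProdFunOver r s) (soloInformedProdDomainOver r s) := by
  have hint : IntegrableOn
      (fun p : (Fin n → ℝ) × (Fin m → ℝ) => r.integrand p.1 * s.integrand p.2)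
      (r.domain ×ˢ s.domain) := by
    rw [IntegrableOn, Measure.volume_eq_prod, ← Measure.prod_restrict]
    exact r.integrableOn.mul_prod s.integrableOn
  have hcomp : soloInformedProdFunOver r s ∘ KZ.appendMeasurableEquiv n m =
      fun p => r.integrand p.1 * s.integrand p.2 := by
    funext p
    simp
  rw [← soloInformed_preimage_prodDomainOver, ← hcomp] at hint
  exact (KZ.volume_preserving_appendMeasurableEquiv.integrableOn_comp_preimage
    (KZ.appendMeasurableEquiv n m).measurableEmbedding).mp hint

/-- **Fubini.** `∫_{σ × τ} f ⊗ g = (∫_σ f) · (∫_τ g)`. -/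
theorem soloInformed_setIntegral_prodFunOver :
    ∫ z in soloInformedProdDomainOver r s, soloInformedProdFunOver r s z = r.value * s.value := by
  rw [← KZ.volume_preserving_appendMeasurableEquiv.setIntegral_preimage_emb
    (KZ.appendMeasurableEquiv n m).measurableEmbedding, soloInformed_preimage_prodDomainOver]
  simp only [KZ.appendMeasurableEquiv_apply, soloInformed_prodFunOver_append]
  rw [Measure.volume_eq_prod, setIntegral_prod_mul]
  rfl

/-- **The product of integral representations over `k`**: `[σ, f] · [τ, g] = [σ × τ, f ⊗ g]` in
dimension `n + m` (Kontsevich–Zagier 2001, §4.1: "the product of integrals is again an integral").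
No classical `if`: the integrand IS `f ⊗ g`. -/
def soloInformedProdOver : KZOver.IntegralRep k (n + m) where
  domain := soloInformedProdDomainOver r s
  integrand := soloInformedProdFunOver r s
  isSemialgebraic_domain := soloInformed_isSemialgebraic_prodDomainOver r s
  isSemialgebraicFunOn_integrand := soloInformed_isSemialgebraicFunOn_prodFunOver r s
  integrableOn := soloInformed_integrableOn_prodFunOver r s

/-- The domain of the product representation. -/
@[simp] theorem soloInformed_prodOver_domain :
    (soloInformedProdOver r s).domain = soloInformedProdDomainOver r s := rfl

/-- The integrand of the product representation. -/
@[simp] theorem soloInformed_prodOver_integrand :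
    (soloInformedProdOver r s).integrand = soloInformedProdFunOver r s := rfl

/-- **Multiplicativity of the value** (Fubini): `value [σ × τ, f ⊗ g] = value [σ, f] · value [τ, g]`. -/
theorem soloInformed_value_prodOver :
    (soloInformedProdOver r s).value = r.value * s.value :=
  soloInformed_setIntegral_prodFunOver r s

end Prod

/-! ### The product on `KZOver.FormalRep k` -/

/-- Multiplication of generators: `⟨n, r⟩ * ⟨m, s⟩ = ⟨n + m, r × s⟩`.  Through Mathlib's
`FreeAbelianGroup.nonUnitalNonAssocRing` this equips `KZOver.FormalRep k` with the biadditive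
product extending `soloInformedProdOver`. -/
instance soloInformedSigmaMulOver : Mul (Σ n, KZOver.IntegralRep k n) :=
  ⟨fun r s => ⟨r.1 + s.1, soloInformedProdOver r.2 s.2⟩⟩

/-- Unfolding the product of generators. -/
theorem soloInformed_sigmaMulOver_def (r s : Σ n, KZOver.IntegralRep k n) :
    r * s = ⟨r.1 + s.1, soloInformedProdOver r.2 s.2⟩ := rfl

/-- On generators the product of `KZOver.FormalRep k` is the product representation:
`[r] * [s] = [r × s]`. -/
theorem soloInformed_ofOver_mul_ofOver (r : KZOver.IntegralRep k n) (s : KZOver.IntegralRep k m) :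
    KZOver.of r * KZOver.of s = KZOver.of (soloInformedProdOver r s) :=
  FreeAbelianGroup.of_mul_of _ _

/-- A property of products of `KZOver.FormalRep k` that is additive in each variable and holds on
generators holds everywhere (double `FreeAbelianGroup.induction_on`). -/
theorem soloInformed_formalRepOver_mul_induction {p : KZOver.FormalRep k → KZOver.FormalRep k → Prop}
    (hof : ∀ (n m : ℕ) (r : KZOver.IntegralRep k n) (s : KZOver.IntegralRep k m),
      p (KZOver.of r) (KZOver.of s))
    (hzero_left : ∀ d, p 0 d) (hzero_right : ∀ c, p c 0)
    (hneg_left : ∀ c d, p c d → p (-c) d) (hneg_right : ∀ c d, p c d → p c (-d))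
    (hadd_left : ∀ c c' d, p c d → p c' d → p (c + c') d)
    (hadd_right : ∀ c d d', p c d → p c d' → p c (d + d')) (c d : KZOver.FormalRep k) : p c d := by
  induction c using FreeAbelianGroup.induction_on with
  | zero => exact hzero_left d
  | of x =>
    induction d using FreeAbelianGroup.induction_on with
    | zero => exact hzero_right _
    | of y => exact hof x.1 y.1 x.2 y.2
    | neg y ih => exact hneg_right _ _ ih
    | add y z ihy ihz => exact hadd_right _ _ _ ihy ihz
  | neg x ih => exact hneg_left _ _ ih
  | add x y ihx ihy => exact hadd_left _ _ _ ihx ihy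

variable (k) in
/-- **`eval` is multiplicative on `KZOver.FormalRep k`**: `eval (c * c') = eval c · eval c'`
(biadditivity and Fubini on generators, `soloInformed_value_prodOver`). -/
theorem soloInformed_evalOver_mul (c c' : KZOver.FormalRep k) :
    KZOver.eval k (c * c') = KZOver.eval k c * KZOver.eval k c' := by
  refine soloInformed_formalRepOver_mul_induction
    (p := fun c c' => KZOver.eval k (c * c') = KZOver.eval k c * KZOver.eval k c')
    ?_ ?_ ?_ ?_ ?_ ?_ ?_ c c'
  · intro n m r s
    rw [soloInformed_ofOver_mul_ofOver, KZOver.eval_of, KZOver.eval_of, KZOver.eval_of,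
      soloInformed_value_prodOver]
  · intro d; simp
  · intro c; simp
  · intro c d h; rw [neg_mul, map_neg, h, map_neg, neg_mul]
  · intro c d h; rw [mul_neg, map_neg, h, map_neg, mul_neg]
  · intro c c' d h h'; rw [add_mul, map_add, h, h', map_add, add_mul]
  · intro c d d' h h'; rw [mul_add, map_add, h, h', map_add, mul_add]

/-! ### Base change is multiplicative -/

section BaseChange

variable (k' : Type*) [CommRing k'] [Algebra k' ℝ] [Algebra k k'] [IsScalarTower k k' ℝ]

/-- Base change of a product representation is the product of the base changes (same domain,
same integrand). -/
theorem soloInformed_prodOver_baseChange (r : KZOver.IntegralRep k n) (s : KZOver.IntegralRep k m) :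
    (soloInformedProdOver r s).baseChange k' =
      soloInformedProdOver (r.baseChange k') (s.baseChange k') :=
  KZOver.IntegralRep.ext rfl rfl

/-- **Base change `KZ_k → KZ_{k'}` is multiplicative**:
`baseChange (c * c') = baseChange c * baseChange c'`. -/
theorem soloInformed_baseChangeOver_mul (c c' : KZOver.FormalRep k) :
    KZOver.baseChange k k' (c * c') = KZOver.baseChange k k' c * KZOver.baseChange k k' c' := by
  refine soloInformed_formalRepOver_mul_induction
    (p := fun c c' => KZOver.baseChange k k' (c * c') =
      KZOver.baseChange k k' c * KZOver.baseChange k k' c') ?_ ?_ ?_ ?_ ?_ ?_ ?_ c c'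
  · intro n m r s
    rw [soloInformed_ofOver_mul_ofOver, KZOver.baseChange_of, KZOver.baseChange_of,
      KZOver.baseChange_of, soloInformed_ofOver_mul_ofOver, soloInformed_prodOver_baseChange]
  · intro d; simp
  · intro c; simp
  · intro c d h; rw [neg_mul, map_neg, h, map_neg, neg_mul]
  · intro c d h; rw [mul_neg, map_neg, h, map_neg, mul_neg]
  · intro c c' d h h'; rw [add_mul, map_add, h, h', map_add, add_mul]
  · intro c d d' h h'; rw [mul_add, map_add, h, h', map_add, mul_add]

end BaseChange

/-! ### On `ℚ`-data the product is the product of `KZProduct.lean` -/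

/-- For KZ representations `r`, `s` (file `KZCalculus`), the product over `ℚ` of `ofKZ r`, `ofKZ s`
is `ofKZ (r.prod s)`: same domain `σ × τ`, and the integrand of `r.prod s` is `f ⊗ g`
(`KZ.IntegralRep.prod_integrand_eq`: the classical `if` of `KZ.IntegralRep.prod` takes its
intended branch). -/
theorem soloInformed_prodOver_ofKZ (r : KZ.IntegralRep n) (s : KZ.IntegralRep m) :
    soloInformedProdOver (KZOver.IntegralRep.ofKZ r) (KZOver.IntegralRep.ofKZ s) =
      KZOver.IntegralRep.ofKZ (r.prod s) := by
  refine KZOver.IntegralRep.ext rfl ?_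
  show soloInformedProdFunOver _ _ = (KZ.IntegralRep.prod r s).integrand
  rw [KZ.IntegralRep.prod_integrand_eq]
  rfl

/-- **`KZOver.equivKZ : KZ.FormalRep ≃+ FormalRep ℚ` is multiplicative**: the product of this file
restricts, on KZ's calculus, to the product of `KZProduct.lean`. -/
theorem soloInformed_equivKZ_mul (c c' : KZ.FormalRep) :
    KZOver.equivKZ (c * c') = KZOver.equivKZ c * KZOver.equivKZ c' := by
  induction c using FreeAbelianGroup.induction_on with
  | zero => simp
  | of x =>
    induction c' using FreeAbelianGroup.induction_on with
    | zero => simp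
    | of y =>
      obtain ⟨n, r⟩ := x
      obtain ⟨m, s⟩ := y
      change KZOver.equivKZ (KZ.of r * KZ.of s) = KZOver.equivKZ (KZ.of r) * KZOver.equivKZ (KZ.of s)
      rw [KZ.of_mul_of, KZOver.equivKZ_of, KZOver.equivKZ_of, KZOver.equivKZ_of,
        soloInformed_ofOver_mul_ofOver, soloInformed_prodOver_ofKZ]
    | neg y ih => rw [mul_neg, map_neg, ih, map_neg, mul_neg]
    | add y z ihy ihz => rw [mul_add, map_add, ihy, ihz, map_add, mul_add]
  | neg x ih => rw [neg_mul, map_neg, ih, map_neg, neg_mul]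
  | add x y ihx ihy => rw [add_mul, map_add, ihx, ihy, map_add, add_mul]

/-- `equivKZ` transports "`c · d − d' ∈ KZ.relations`"-type statements: membership of a product in
`KZ.relations` is membership of the product of the images in `KZOver.relations ℚ`. -/
theorem soloInformed_mul_mem_relationsKZ_iff (c c' : KZ.FormalRep) :
    c * c' ∈ KZ.relations ↔ KZOver.equivKZ c * KZOver.equivKZ c' ∈ KZOver.relations ℚ := by
  rw [← soloInformed_equivKZ_mul, KZOver.equivKZ_mem_relations_iff]

end Summit.KontsevichZagierPeriods.KontsevichZagierPeriods.Theorems
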